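import Summits.CriticalPhenomena.SAWScalingLimit.Theorems.EventualTight.Negative.Snake2Lattice

/-!
# `EventualTight` — negative knowledge: boundary regularity is load-bearing (the dyadic snake)

Part 3: room versus tail — every mesh vertex of abscissa `> 16 δ` reaches the base point, the tail (abscissa `≤ 16 δ`) injects non-surjectively into `col 0`, hence the main component is the UNIQUE largest one: `meshDomain Ω δ` identified (`meshDomain_eq`), room points are joined in `Ω_δ` (`reachable_dd`).

Support files for the crux `stmt-CriticalPhenomena-1372`
(`Summit.CriticalPhenomena.SAWScalingLimit.Theses.SAWRenewalTightness.EventualTight`; refuter `cdisprove`,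
standing adversary; indexed work file
`Summits/CriticalPhenomena/SAWScalingLimit/Cruxes/EventualTight/Disproof.lean`, §5). The four parts
`Snake1Domain … Snake4Forcing` prove: over bounded open CONNECTED sets with two distinct marked FRONTIER
points (all the fields of `DobrushinDomain` except the Jordan boundary loop), the statement of the crux
is FALSE — so any proof of `EventualTight` must use the boundary loop (local connectivity of `∂Ω` at the
marked points). Everything proved, standard axioms. [folklore]
-/

noncomputable section

open MeasureTheory Filter Topology Set Metric Complex
open Literature.Probability.RandomPlanarGeometry Literature.Probability.RandomPlanarGeometry.SAW
  Literature.Probability.LatticeModels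
open scoped ENNReal NNReal unitInterval

namespace Summit.CriticalPhenomena.SAWScalingLimit.Theorems.EventualTight.Negative

open Summit.CriticalPhenomena.SAWScalingLimit.Theorems.ShellCrossingBound.Negative
  (exists_forall_not_hasTraversals_of_isCompact)
open Summit.CriticalPhenomena.SAWScalingLimit.Theorems.ShellCrossingBound.Negative.Forcing
  (meshPoint_vec vec_add_single_zero vec_add_single_one eq_vec exists_chain chain_lt
    range_toCurve_subset toCurve_apply_one isProbabilityMeasure_law abs_im_sub_le_dist)

namespace Snake

/-! ### Room versus tail: the room holds the unique largest component -/

/-- Room: mesh vertices of abscissa index `> 16`. [folklore] -/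
def RS (δ : ℝ) : Set (Site 2) := {v | v ∈ meshVertices Ω δ ∧ 16 < v 0}

/-- Tail: mesh vertices of abscissa index `≤ 16`. [folklore] -/
def TS (δ : ℝ) : Set (Site 2) := {v | v ∈ meshVertices Ω δ ∧ v 0 ≤ 16}

/-- Every room vertex reaches the base point. [folklore] -/
theorem reach_v₀_of_mem_RS {δ : ℝ} (hδ : 0 < δ) (hδs : δ < 1 / 64) {v : Site 2} (hv : v ∈ RS δ) :
    Reach δ v (v₀ δ) := by
  obtain ⟨hvm, hv16⟩ := hv
  rw [eq_vec v] at hvm ⊢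
  have hz := vec_mem_iff.1 hvm
  obtain ⟨k, hk⟩ := mem_iUnion.1 hz
  have h17 : (17 : ℝ) ≤ v 0 := by exact_mod_cast hv16
  have hres_of : δ * v 0 < r k → 16 * δ < r k := fun h => by nlinarith
  rcases hk with hk | hk
  · exact reach_v₀_of_col hδ hδs k (hres_of hk.1.2) _ _ hk
  · exact reach_v₀_of_conn hδ hδs (hres_of hk.1.2) hk

/-- Snake bookkeeping (`v₀_mem_RS`). [folklore] -/
theorem v₀_mem_RS {δ : ℝ} (hδ : 0 < δ) (hδs : δ < 1 / 64) : v₀ δ ∈ RS δ := by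
  refine ⟨col_subset_Ω 0 (meshPoint_v₀_mem hδ (by linarith)), ?_⟩
  show (16 : ℤ) < ib δ
  obtain ⟨h1, -⟩ := nxt_bounds hδ (5 / 8)
  have : (16 : ℝ) < nxt δ (5 / 8) := by
    by_contra h
    push Not at h
    nlinarith
  exact_mod_cast this

/-- The tail-to-room injection: shift by `ib δ` columns into `col 0`. [folklore] -/
def fsh (δ : ℝ) (v : Site 2) : Site 2 := ![v 0 + ib δ, v 1]

/-- Snake bookkeeping (`fsh_injective`). [folklore] -/
theorem fsh_injective (δ : ℝ) : Function.Injective (fsh δ) := by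
  intro v w h
  have h0 := congrFun h 0
  have h1 := congrFun h 1
  simp only [fsh, Matrix.cons_val_zero, Matrix.cons_val_one] at h0 h1
  rw [eq_vec v, eq_vec w, h1, show v 0 = w 0 by linarith]

/-- Abscissa indices of mesh vertices are positive. [folklore] -/
theorem one_le_of_mem {δ : ℝ} (hδ : 0 < δ) {v : Site 2} (hv : v ∈ meshVertices Ω δ) : 1 ≤ v 0 := by
  rw [eq_vec v] at hv
  have h := (re_im_of_mem (vec_mem_iff.1 hv)).1
  simp only at h
  have : (0 : ℝ) < v 0 := by nlinarith
  exact_mod_cast this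

/-- Snake bookkeeping (`im_mem_of_mem`). [folklore] -/
theorem im_mem_of_mem {δ : ℝ} {v : Site 2} (hv : v ∈ meshVertices Ω δ) : δ * v 1 ∈ Ioo (0:ℝ) 1 := by
  rw [eq_vec v] at hv
  have h := re_im_of_mem (vec_mem_iff.1 hv)
  exact ⟨h.2.2.1, h.2.2.2⟩

/-- Snake bookkeeping (`fsh_mem`). [folklore] -/
theorem fsh_mem {δ : ℝ} (hδ : 0 < δ) (hδs : δ < 1 / 64) {v : Site 2} (hv : v ∈ TS δ) :
    fsh δ v ∈ RS δ := by
  obtain ⟨hvm, hv16⟩ := hv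
  have h1 := one_le_of_mem hδ hvm
  have him := im_mem_of_mem hvm
  obtain ⟨hb1, hb2⟩ := nxt_bounds hδ (5 / 8)
  have h1' : (1 : ℝ) ≤ v 0 := by exact_mod_cast h1
  have h16' : (v 0 : ℝ) ≤ 16 := by exact_mod_cast hv16
  refine ⟨?_, ?_⟩
  · show fsh δ v ∈ meshVertices Ω δ
    unfold fsh
    refine vec_mem_iff.2 (col_subset_Ω 0 ⟨⟨?_, ?_⟩, him⟩)
    · unfold l ib at *; rw [r_zero]; push_cast; nlinarith
    · unfold ib at *; rw [r_zero]; push_cast; nlinarith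
  · show (16 : ℤ) < v 0 + ib δ
    have : (16 : ℝ) < nxt δ (5 / 8) := by
      by_contra h; push Not at h; nlinarith
    have h16 : (16 : ℤ) < ib δ := by exact_mod_cast this
    linarith

/-- A room point beyond the image of the tail. [folklore] -/
def rfar (δ : ℝ) : Site 2 := ![17 + ib δ, 1]

/-- Snake bookkeeping (`rfar_mem`). [folklore] -/
theorem rfar_mem {δ : ℝ} (hδ : 0 < δ) (hδs : δ < 1 / 64) : rfar δ ∈ RS δ := by
  obtain ⟨hb1, hb2⟩ := nxt_bounds hδ (5 / 8)
  refine ⟨?_, ?_⟩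
  · unfold rfar
    refine vec_mem_iff.2 (col_subset_Ω 0 ⟨⟨?_, ?_⟩, one_mem_Ioo hδ (by linarith)⟩)
    · unfold l ib; rw [r_zero]; push_cast; nlinarith
    · unfold ib; rw [r_zero]; push_cast; nlinarith
  · show (16 : ℤ) < 17 + ib δ
    have : (16 : ℝ) < nxt δ (5 / 8) := by
      by_contra h; push Not at h; nlinarith
    have h16 : (16 : ℤ) < ib δ := by exact_mod_cast this
    linarith

/-- Snake bookkeeping (`rfar_not_mem_image`). [folklore] -/
theorem rfar_not_mem_image {δ : ℝ} : rfar δ ∉ fsh δ '' TS δ := by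
  rintro ⟨v, hv, hfv⟩
  have h0 := congrFun hfv 0
  simp only [fsh, rfar, Matrix.cons_val_zero] at h0
  have := hv.2
  linarith

/-- Snake bookkeeping (`finite_meshVertices`). [folklore] -/
theorem finite_meshVertices {δ : ℝ} (hδ : 0 < δ) : (meshVertices Ω δ).Finite :=
  meshVertices_finite isBounded_Ω hδ

/-- **The tail is smaller than the room.** [folklore] -/
theorem ncard_TS_lt {δ : ℝ} (hδ : 0 < δ) (hδs : δ < 1 / 64) : (TS δ).ncard < (RS δ).ncard := by
  rw [← Set.ncard_image_of_injective (TS δ) (fsh_injective δ)]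
  apply Set.ncard_lt_ncard _ ((finite_meshVertices hδ).subset fun _ hv => hv.1)
  refine ⟨?_, fun h => rfar_not_mem_image (h (rfar_mem hδ hδs))⟩
  rintro _ ⟨v, hv, rfl⟩
  exact fsh_mem hδ hδs hv

section Component

variable {δ : ℝ} (hδ : 0 < δ) (hδs : δ < 1 / 64)
include hδ hδs

/-- The main component: the component of the base point. [folklore] -/
def mainC : (meshVertexGraph Ω δ).ConnectedComponent :=
  (meshVertexGraph Ω δ).connectedComponentMk ⟨v₀ δ, (v₀_mem_RS hδ hδs).1⟩

/-- Snake bookkeeping (`RS_subset_main`). [folklore] -/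
theorem RS_subset_main : RS δ ⊆ Subtype.val '' (mainC hδ hδs).supp := by
  intro v hv
  refine ⟨⟨v, hv.1⟩, ?_, rfl⟩
  rw [SimpleGraph.ConnectedComponent.mem_supp_iff, mainC, SimpleGraph.ConnectedComponent.eq]
  obtain ⟨hu, hw, h⟩ := reach_v₀_of_mem_RS hδ hδs hv
  exact h

/-- Snake bookkeeping (`image_supp_subset_TS`). [folklore] -/
theorem image_supp_subset_TS {C : (meshVertexGraph Ω δ).ConnectedComponent}
    (hC : C ≠ mainC hδ hδs) : Subtype.val '' C.supp ⊆ TS δ := by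
  rintro _ ⟨v, hv, rfl⟩
  refine ⟨v.2, ?_⟩
  by_contra hlt
  rw [not_le] at hlt
  obtain ⟨w, hw, hwv⟩ := RS_subset_main hδ hδs ⟨v.2, hlt⟩
  have hwv' : w = v := Subtype.ext hwv
  subst hwv'
  rw [SimpleGraph.ConnectedComponent.mem_supp_iff] at hv hw
  exact hC (hv.symm.trans hw)

/-- Snake bookkeeping (`ncard_supp_lt`). [folklore] -/
theorem ncard_supp_lt {C : (meshVertexGraph Ω δ).ConnectedComponent} (hC : C ≠ mainC hδ hδs) :
    C.supp.ncard < (mainC hδ hδs).supp.ncard := by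
  have h1 : C.supp.ncard = (Subtype.val '' C.supp).ncard :=
    (Set.ncard_image_of_injective _ Subtype.val_injective).symm
  have h2 : (mainC hδ hδs).supp.ncard = (Subtype.val '' (mainC hδ hδs).supp).ncard :=
    (Set.ncard_image_of_injective _ Subtype.val_injective).symm
  rw [h1, h2]
  have hfin : (Subtype.val '' (mainC hδ hδs).supp).Finite :=
    (finite_meshVertices hδ).subset (by rintro _ ⟨v, -, rfl⟩; exact v.2)
  calc (Subtype.val '' C.supp).ncard ≤ (TS δ).ncard :=
        Set.ncard_le_ncard (image_supp_subset_TS hδ hδs hC)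
          ((finite_meshVertices hδ).subset fun _ hv => hv.1)
    _ < (RS δ).ncard := ncard_TS_lt hδ hδs
    _ ≤ (Subtype.val '' (mainC hδ hδs).supp).ncard := Set.ncard_le_ncard (RS_subset_main hδ hδs) hfin

/-- Snake bookkeeping (`main_max`). [folklore] -/
theorem main_max (C : (meshVertexGraph Ω δ).ConnectedComponent) :
    C.supp.ncard ≤ (mainC hδ hδs).supp.ncard := by
  by_cases hC : C = mainC hδ hδs
  · rw [hC]
  · exact (ncard_supp_lt hδ hδs hC).le

/-- **The discrete snake `Ω_δ` is the main component** (largest-component convention, by counting). [folklore] -/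
theorem meshDomain_eq : meshDomain Ω δ = Subtype.val '' (mainC hδ hδs).supp := by
  apply Subset.antisymm
  · intro x hx
    simp only [meshDomain, mem_iUnion] at hx
    obtain ⟨C, hC, hx⟩ := hx
    have hCm : C = mainC hδ hδs := by
      by_contra hne
      have h1 := ncard_supp_lt hδ hδs hne
      have h2 := hC (mainC hδ hδs)
      omega
    rw [← hCm]; exact hx
  · intro x hx
    simp only [meshDomain, mem_iUnion]
    exact ⟨mainC hδ hδs, main_max hδ hδs, hx⟩

/-- Snake bookkeeping (`reachable_dd_of_walk`). [folklore] -/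
theorem reachable_dd_of_walk {u v : meshVertices Ω δ} (p : (meshVertexGraph Ω δ).Walk u v)
    (hu : u ∈ (mainC hδ hδs).supp) : (discreteDomainGraph Ω δ).Reachable u.1 v.1 := by
  induction p with
  | nil => exact SimpleGraph.Reachable.refl _
  | @cons a b c hadj p ih =>
    have hb : b ∈ (mainC hδ hδs).supp := by
      rw [SimpleGraph.ConnectedComponent.mem_supp_iff] at hu ⊢
      rw [← hu]
      exact (SimpleGraph.ConnectedComponent.eq.2 hadj.reachable).symm
    have hdom : ∀ w : meshVertices Ω δ, w ∈ (mainC hδ hδs).supp → w.1 ∈ meshDomain Ω δ :=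
      fun w hw => by rw [meshDomain_eq hδ hδs]; exact ⟨w, hw, rfl⟩
    have hadj' : (discreteDomainGraph Ω δ).Adj a.1 b.1 := by
      rw [discreteDomainGraph_adj_iff]
      refine ⟨?_, hdom a hu, hdom b hb⟩
      simpa [SimpleGraph.comap_adj] using hadj
    exact hadj'.reachable.trans (ih hb)

/-- **Room points are joined in `Ω_δ`.** [folklore] -/
theorem reachable_dd {u v : Site 2} (hu : u ∈ RS δ) (hv : v ∈ RS δ) :
    (discreteDomainGraph Ω δ).Reachable u v := by
  obtain ⟨hu', h0, h⟩ := (reach_v₀_of_mem_RS hδ hδs hu).trans (reach_v₀_of_mem_RS hδ hδs hv).symm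
  obtain ⟨p⟩ := h
  have humain : (⟨u, hu'⟩ : meshVertices Ω δ) ∈ (mainC hδ hδs).supp := by
    obtain ⟨w, hw, hwu⟩ := RS_subset_main hδ hδs hu
    have : w = ⟨u, hu'⟩ := Subtype.ext hwu
    rw [← this]; exact hw
  exact reachable_dd_of_walk hδ hδs p humain

end Component

end Snake

end Summit.CriticalPhenomena.SAWScalingLimit.Theorems.EventualTight.Negative

end
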